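import Mathlib.Algebra.MvPolynomial.Equiv
import Mathlib.Algebra.MvPolynomial.Nilpotent
import Mathlib.Algebra.Polynomial.Div
import Literature.NumberTheory.DiophantineGeometry.PlaneSectionCountingProofs
import HarnessLib

/-!
# Hyperplane slices of an irreducible hypersurface and the plane sections on which it vanishes

Library file (theorems only), continuing `PlaneSectionCountingProofs`. Let `K = 𝔽_q` and
`f ∈ K[x₀, …, xₙ]` be irreducible of total degree `δ ≥ 2`.

* `card_filter_eval_cons_eq_zero_le`: **no hyperplane `x₀ = c` lies in the hypersurface `f = 0`**,
  so the slice `{w ∈ Kⁿ : f(c, w) = 0}` has at most `δ q^{n-1}` points (Lemma 2.1 applied to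
  `f(c, x₁, …, xₙ) ≠ 0`; it is nonzero because otherwise `x₀ - c ∣ f`);
* `card_filter_planeSection_eq_zero_le`: consequently, for each fixed `η`, **the number of
  `(ν, ω) ∈ K^{n+1} × Kⁿ` for which the plane section `f_{ν,ω,η}` is the zero polynomial is at most
  `N(f) · δ q^{n-1}`** — such a plane lies in the hypersurface, so `ν` is a zero of `f` and so is the
  point `ν + (1, ω)` of the slice `x₀ = ν₀ + 1`.

This replaces, in the parametrised form of the averaging argument, Cafure–Matera's bound (18) for
the number `C` of planes contained in the hypersurface (there derived from Lemma 2.2 after a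
reduction to polynomials depending on all variables).

## References

* A. Cafure, G. Matera, Finite Fields Appl. 12 (2006) 155–185, Lemma 2.1, §5.1 eq. (18).
  [CafureMatera2006]
-/

noncomputable section

open MvPolynomial Literature.RingTheory.MvPolynomial

namespace Literature.NumberTheory.DiophantineGeometry

variable {K : Type*} [Field K] {n : ℕ}

/-! ### The slice polynomial `f(c, x₁, …, xₙ)` -/

/-- The slice polynomial `f(c, x₁, …, xₙ)`, as the value at `C c` of `f` read in
`(K[x₁, …, xₙ])[x₀]`, is the substitution `x₀ ↦ c`. [folklore] -/
theorem eval_C_finSuccEquiv_eq_aeval (f : MvPolynomial (Fin (n + 1)) K) (c : K) :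
    (finSuccEquiv K n f).eval (C c) =
      MvPolynomial.aeval (Fin.cons (C c) X : Fin (n + 1) → MvPolynomial (Fin n) K) f := by
  have h : ((Polynomial.aeval (R := MvPolynomial (Fin n) K) (C c : MvPolynomial (Fin n) K)).restrictScalars
        K).comp (finSuccEquiv K n).toAlgHom =
      MvPolynomial.aeval (Fin.cons (C c) X : Fin (n + 1) → MvPolynomial (Fin n) K) := by
    refine MvPolynomial.algHom_ext fun i ↦ ?_
    refine Fin.cases ?_ (fun j ↦ ?_) i
    · simp [finSuccEquiv_X_zero]
    · simp [finSuccEquiv_X_succ]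
  have := congrArg (fun φ ↦ φ f) h
  simpa [Polynomial.aeval_def, Polynomial.eval₂_eq_eval_map, Polynomial.map_id] using this

/-- Evaluating the slice polynomial: `f(c, ·)(s) = f(c, s)`. [folklore] -/
theorem eval_eval_C_finSuccEquiv (f : MvPolynomial (Fin (n + 1)) K) (c : K) (s : Fin n → K) :
    MvPolynomial.eval s ((finSuccEquiv K n f).eval (C c)) = MvPolynomial.eval (Fin.cons c s) f := by
  rw [eval_eq_eval_mv_eval', Polynomial.eval_map, ← Polynomial.eval₂_at_apply, eval_C]

/-- The slice polynomial has total degree at most `deg f`. [folklore] -/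
theorem totalDegree_eval_C_finSuccEquiv_le (f : MvPolynomial (Fin (n + 1)) K) (c : K) :
    ((finSuccEquiv K n f).eval (C c)).totalDegree ≤ f.totalDegree := by
  rw [eval_C_finSuccEquiv_eq_aeval]
  refine totalDegree_aeval_le_of_le_one _ (fun i ↦ ?_) f
  refine Fin.cases ?_ (fun j ↦ ?_) i
  · rw [Fin.cons_zero, totalDegree_C]; exact Nat.zero_le _
  · rw [Fin.cons_succ]; exact (totalDegree_X (R := K) j).le

/-- If the slice polynomial vanishes then `x₀ - c` divides `f`. [folklore] -/
theorem X_sub_C_dvd_of_eval_C_finSuccEquiv_eq_zero {f : MvPolynomial (Fin (n + 1)) K} {c : K}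
    (h : (finSuccEquiv K n f).eval (C c) = 0) : (X 0 - C c : MvPolynomial (Fin (n + 1)) K) ∣ f := by
  have hdvd : (Polynomial.X - Polynomial.C (C c)) ∣ finSuccEquiv K n f :=
    (Polynomial.dvd_iff_isRoot).2 h
  have h2 := map_dvd ((finSuccEquiv K n).symm : Polynomial (MvPolynomial (Fin n) K) →+* MvPolynomial (Fin (n + 1)) K) hdvd
  rw [map_sub] at h2
  have hX : ((finSuccEquiv K n).symm : Polynomial (MvPolynomial (Fin n) K) →+* MvPolynomial (Fin (n + 1)) K)
      Polynomial.X = X 0 := by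
    rw [← finSuccEquiv_X_zero]; exact (finSuccEquiv K n).symm_apply_apply _
  have hC : ((finSuccEquiv K n).symm : Polynomial (MvPolynomial (Fin n) K) →+* MvPolynomial (Fin (n + 1)) K)
      (Polynomial.C (C c)) = C c := by
    have h1 : finSuccEquiv K n (C c) = Polynomial.C (C c) := by
      rw [finSuccEquiv_apply, eval₂Hom_C, RingHom.comp_apply]
    rw [← h1]; exact (finSuccEquiv K n).symm_apply_apply _
  have hf : ((finSuccEquiv K n).symm : Polynomial (MvPolynomial (Fin n) K) →+* MvPolynomial (Fin (n + 1)) K)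
      (finSuccEquiv K n f) = f :=
    (finSuccEquiv K n).symm_apply_apply _
  rwa [hX, hC, hf] at h2

/-- `x₀ - c` is not a unit (it vanishes at a point). [folklore] -/
theorem not_isUnit_X_sub_C (c : K) : ¬ IsUnit (X 0 - C c : MvPolynomial (Fin (n + 1)) K) := by
  intro hu
  have h := hu.map (MvPolynomial.eval (Fin.cons c 0 : Fin (n + 1) → K))
  rw [map_sub, eval_X, eval_C, Fin.cons_zero, sub_self] at h
  exact not_isUnit_zero h

/-- **An irreducible `f` of degree `≥ 2` is not divisible by `x₀ - c`.** [folklore] -/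
theorem not_X_sub_C_dvd_of_irreducible {f : MvPolynomial (Fin (n + 1)) K} (hirr : Irreducible f)
    (h2 : 2 ≤ f.totalDegree) (c : K) : ¬ (X 0 - C c : MvPolynomial (Fin (n + 1)) K) ∣ f := by
  rintro ⟨g, hg⟩
  rcases hirr.isUnit_or_isUnit hg with hu | hu
  · exact not_isUnit_X_sub_C c hu
  · have hg0 : g.totalDegree = 0 := ((isUnit_iff_totalDegree_of_isReduced).1 hu).2
    have hle : f.totalDegree ≤ 1 := by
      rw [hg]
      refine (totalDegree_mul _ _).trans ?_
      rw [hg0, add_zero]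
      refine (totalDegree_sub _ _).trans (max_le ?_ ?_)
      · exact (totalDegree_X (R := K) (0 : Fin (n + 1))).le
      · rw [totalDegree_C]; exact Nat.zero_le _
    omega

/-- For an irreducible `f` of degree `≥ 2`, no slice polynomial `f(c, x₁, …, xₙ)` vanishes.
[folklore] -/
theorem eval_C_finSuccEquiv_ne_zero {f : MvPolynomial (Fin (n + 1)) K} (hirr : Irreducible f)
    (h2 : 2 ≤ f.totalDegree) (c : K) : (finSuccEquiv K n f).eval (C c) ≠ 0 := fun h ↦
  not_X_sub_C_dvd_of_irreducible hirr h2 c (X_sub_C_dvd_of_eval_C_finSuccEquiv_eq_zero h)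

section Finite

variable [Fintype K] [DecidableEq K]

/-- **Slices of an irreducible hypersurface** (Lemma 2.1 on the hyperplane `x₀ = c`): for `f`
irreducible of degree `δ ≥ 2` and `c ∈ K`, at most `δ q^{n-1}` points `w ∈ Kⁿ` satisfy `f(c, w) = 0`.
[cite: CafureMatera2006, Lemma 2.1] -/
theorem card_filter_eval_cons_eq_zero_le {f : MvPolynomial (Fin (n + 1)) K} (hirr : Irreducible f)
    (h2 : 2 ≤ f.totalDegree) (c : K) :
    ((Finset.univ : Finset (Fin n → K)).filter fun s ↦ MvPolynomial.eval (Fin.cons c s) f = 0).card ≤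
      f.totalDegree * Fintype.card K ^ (n - 1) := by
  have hN : ((Finset.univ : Finset (Fin n → K)).filter fun s ↦ MvPolynomial.eval (Fin.cons c s) f = 0) =
      (Finset.univ.filter fun s ↦ MvPolynomial.eval s ((finSuccEquiv K n f).eval (C c)) = 0) := by
    refine Finset.filter_congr fun s _ ↦ ?_
    rw [eval_eval_C_finSuccEquiv]
  rw [hN]
  calc _ ≤ ((finSuccEquiv K n f).eval (C c)).totalDegree * Fintype.card K ^ (n - 1) :=
        rationalPointCount_le_totalDegree_mul (eval_C_finSuccEquiv_ne_zero hirr h2 c)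
    _ ≤ f.totalDegree * Fintype.card K ^ (n - 1) :=
        Nat.mul_le_mul_right _ (totalDegree_eval_C_finSuccEquiv_le f c)

omit [Fintype K] [DecidableEq K] in
/-- If the plane section is the zero polynomial, the base point `ν` lies on the hypersurface.
[cite: CafureMatera2006, §5.1] -/
theorem eval_eq_zero_of_planeSection_eq_zero {f : MvPolynomial (Fin (n + 1)) K} {ν : Fin (n + 1) → K}
    {ω η : Fin n → K} (h : planeSection f ν ω η = 0) : MvPolynomial.eval ν f = 0 := by
  have h1 := eval_planeSection_self f ν ω η 0
  rw [h, map_zero] at h1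
  have hpt : (Fin.cases ((0 : Fin 2 → K) 0 + ν 0)
      (fun i : Fin n ↦ ω i * (0 : Fin 2 → K) 0 + η i * (0 : Fin 2 → K) 1 + ν i.succ) :
        Fin (n + 1) → K) = ν := by
    funext i
    refine Fin.cases ?_ (fun j ↦ ?_) i <;> simp
  rw [hpt] at h1
  exact h1.symm

omit [Fintype K] [DecidableEq K] in
/-- If the plane section is the zero polynomial, the point `ν + (1, ω)` lies on the hypersurface
(a point of the slice `x₀ = ν₀ + 1`). [cite: CafureMatera2006, §5.1] -/
theorem eval_cons_eq_zero_of_planeSection_eq_zero {f : MvPolynomial (Fin (n + 1)) K}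
    {ν : Fin (n + 1) → K} {ω η : Fin n → K} (h : planeSection f ν ω η = 0) :
    MvPolynomial.eval (Fin.cons (ν 0 + 1) (ω + fun i ↦ ν i.succ) : Fin (n + 1) → K) f = 0 := by
  have h1 := eval_planeSection_self f ν ω η ![1, 0]
  rw [h, map_zero] at h1
  have hpt : (Fin.cases ((![1, 0] : Fin 2 → K) 0 + ν 0)
      (fun i : Fin n ↦ ω i * (![1, 0] : Fin 2 → K) 0 + η i * (![1, 0] : Fin 2 → K) 1 + ν i.succ) :
        Fin (n + 1) → K) = (Fin.cons (ν 0 + 1) (ω + fun i ↦ ν i.succ) : Fin (n + 1) → K) := by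
    funext i
    refine Fin.cases ?_ (fun j ↦ ?_) i
    · simp [add_comm]
    · simp
  rw [hpt] at h1
  exact h1.symm

/-- **The number of `(ν, ω)` for which the plane section `f_{ν,ω,η}` vanishes identically** is at
most `N(f) · δ q^{n-1}`, for `f` irreducible of degree `δ ≥ 2` and any fixed `η`: the plane then lies
in the hypersurface, so `f(ν) = 0` and `ν + (1, ω)` is a point of the slice `x₀ = ν₀ + 1` of the
hypersurface. (Replaces Cafure–Matera's count (18) of the planes contained in the hypersurface.)
[cite: CafureMatera2006, §5.1 eq. (18)] -/
theorem card_filter_planeSection_eq_zero_le {f : MvPolynomial (Fin (n + 1)) K} (hirr : Irreducible f)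
    (h2 : 2 ≤ f.totalDegree) (η : Fin n → K) :
    ((Finset.univ : Finset ((Fin (n + 1) → K) × (Fin n → K))).filter
        fun p ↦ planeSection f p.1 p.2 η = 0).card ≤
      rationalPointCount f * (f.totalDegree * Fintype.card K ^ (n - 1)) := by
  -- the fibre over `ν`: the `ω` with `ν + (1, ω)` on the hypersurface
  let fib : (Fin (n + 1) → K) → Finset (Fin n → K) := fun ν ↦
    Finset.univ.filter fun ω ↦
      MvPolynomial.eval (Fin.cons (ν 0 + 1) (ω + fun i ↦ ν i.succ) : Fin (n + 1) → K) f = 0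
  have hfib_le : ∀ ν, (fib ν).card ≤ f.totalDegree * Fintype.card K ^ (n - 1) := by
    intro ν
    have heq : (fib ν).card = ((Finset.univ : Finset (Fin n → K)).filter
        fun s ↦ MvPolynomial.eval (Fin.cons (ν 0 + 1) s) f = 0).card := by
      simp only [fib, Finset.card_filter]
      exact Fintype.sum_equiv (Equiv.addRight fun i ↦ ν i.succ) _ _
        (fun ω ↦ by rw [Equiv.coe_addRight])
    rw [heq]
    exact card_filter_eval_cons_eq_zero_le hirr h2 _
  set H : Finset (Fin (n + 1) → K) := Finset.univ.filter fun ν ↦ MvPolynomial.eval ν f = 0 with hH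
  have hHcard : H.card = rationalPointCount f := rfl
  have hsub : ((Finset.univ : Finset ((Fin (n + 1) → K) × (Fin n → K))).filter
      fun p ↦ planeSection f p.1 p.2 η = 0) ⊆ H.biUnion fun ν ↦ (fib ν).image fun ω ↦ (ν, ω) := by
    intro p hp
    obtain ⟨-, hp⟩ := Finset.mem_filter.1 hp
    rw [Finset.mem_biUnion]
    refine ⟨p.1, Finset.mem_filter.2 ⟨Finset.mem_univ _, eval_eq_zero_of_planeSection_eq_zero hp⟩, ?_⟩
    rw [Finset.mem_image]
    exact ⟨p.2, Finset.mem_filter.2 ⟨Finset.mem_univ _, eval_cons_eq_zero_of_planeSection_eq_zero hp⟩,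
      rfl⟩
  calc _ ≤ (H.biUnion fun ν ↦ (fib ν).image fun ω ↦ (ν, ω)).card := Finset.card_le_card hsub
    _ ≤ ∑ ν ∈ H, ((fib ν).image fun ω ↦ (ν, ω)).card := Finset.card_biUnion_le
    _ ≤ ∑ ν ∈ H, (f.totalDegree * Fintype.card K ^ (n - 1)) :=
        Finset.sum_le_sum fun ν _ ↦ Finset.card_image_le.trans (hfib_le ν)
    _ = rationalPointCount f * (f.totalDegree * Fintype.card K ^ (n - 1)) := by
        rw [Finset.sum_const, smul_eq_mul, hHcard]

end Finite

end Literature.NumberTheory.DiophantineGeometry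

end
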